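import Summits.QuantumFields.YangMills.Theorems.FemtoCutoffLadderLargeFieldInsensitivityOfRarity
import Summits.QuantumFields.YangMills.Theorems.FemtoTransferGapPhysL2Infinite

/-!
# Route `FemtoCutoffLadder`, crux `LargeFieldInsensitivity` (stmt-QuantumFields-25696): clause 1 `0 < t_κ` UNCONDITIONALLY

Lead seat `ym-line-fcl-p1` g8 (2026-08-28).  The crux (and every restatement of it under discussion, e.g. the lead's B′ with the `A/β²`
allowance) begins with `0 < t_κ`, `t_κ = sSup (rayleighSet su2Rep L β P_κ)` the SF_κ-COMPRESSED top value — Rayleigh quotients of physical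
test functions vanishing at every configuration with a spatial plaquette deviation `2 − Re tr U_p > β^{κ−1}`.  This clause holds on EVERY
lattice, for EVERY `β > 0` and EVERY real `κ`, with no window and no rarity hypothesis: the indicator `1_{SF}` of the small-field region
`SF = {U | ∀ p, 2 − Re tr U_p ≤ β^{κ−1}}` is physical (`SFCompression.sf_cutoffs_isPhys`), is supported in `SF`, has positive `L²` mass (`SF`
contains the open neighbourhood `{∀ p, 2 − Re tr U_p < β^{κ−1}}` of the trivial configuration and the a-priori measure charges open sets,
`PhysL2.isOpenPosMeasure_configMeasure`), and `⟨1_{SF}, K_β 1_{SF}⟩ ≥ (inf K_β)·μ(SF)² > 0` (pointwise positive kernel).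

★ `smallFieldTop_pos : 0 < β → 0 < sSup (rayleighSet su2Rep L β P_κ)` (the crux's clause 1, by `exact`).

HONEST FRAMING: elementary; the two comparison clauses of the crux (the content) are untouched.  R2b1 is a RECORD rung — not infinite volume,
not a mass gap, not Clay; no summit is proved by this line.  No definitions, no named facts, no `sorry`.
-/

set_option autoImplicit false

noncomputable section

open MeasureTheory Filter Topology Real
open Literature.MathematicalPhysics.QuantumFieldTheory
open Literature.MathematicalPhysics.QuantumLattice

namespace Summit.QuantumFields.YangMills.Theorems.FemtoTransferGap.SFCompression

variable {L : ℕ} [NeZero L]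

/-- A nonnegative lower bound `m ≤ K_β` transfers to `K_β ψ ≥ m ∫ψ` pointwise for a nonnegative bounded measurable `ψ`. [folklore] -/
theorem const_mul_integral_le_transferApply (β : ℝ) {m : ℝ}
    (hm : ∀ U V : GaugeConfig 3 L SU2, m ≤ transferKernel su2Rep β U V)
    {ψ : GaugeConfig 3 L SU2 → ℝ} (hψm : Measurable ψ) {C : ℝ} (hψb : ∀ V, |ψ V| ≤ C) (hψ0 : ∀ V, 0 ≤ ψ V)
    (U : GaugeConfig 3 L SU2) :
    m * ∫ V, ψ V ∂(configMeasure SU2 L) ≤ transferApply β ψ U := by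
  rw [transferApply_apply, ← integral_const_mul]
  have hint : Integrable (fun V => m * ψ V) (configMeasure SU2 L) := by
    refine Integrable.const_mul ?_ m
    exact Integrable.mono' (integrable_const C) hψm.aestronglyMeasurable
      (ae_of_all _ fun V => by rw [Real.norm_eq_abs]; exact hψb V)
  exact integral_mono hint (integrable_transferKernel_mul β U hψm hψb) fun V =>
    mul_le_mul_of_nonneg_right (hm U V) (hψ0 V)

/-- For a nonnegative physical `ψ` and `m ≤ K_β`: `⟨ψ, K_β ψ⟩ ≥ m (∫ψ)²`. [folklore] -/
theorem sq_integral_le_qform (β : ℝ) {m : ℝ}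
    (hm : ∀ U V : GaugeConfig 3 L SU2, m ≤ transferKernel su2Rep β U V)
    {ψ : GaugeConfig 3 L SU2 → ℝ} (hψ : IsPhys ψ) (hψ0 : ∀ V, 0 ≤ ψ V) :
    m * (∫ V, ψ V ∂(configMeasure SU2 L)) ^ 2 ≤ qform su2Rep β ψ ψ := by
  obtain ⟨C, hC⟩ := hψ.bounded
  rw [qform_eq_l2_transferApply]
  unfold l2
  set I : ℝ := ∫ V, ψ V ∂(configMeasure SU2 L) with hI
  have hptw : ∀ U, ψ U * (m * I) ≤ ψ U * transferApply β ψ U := fun U =>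
    mul_le_mul_of_nonneg_left (const_mul_integral_le_transferApply β hm hψ.measurable hC hψ0 U) (hψ0 U)
  -- integrability of both sides
  obtain ⟨M, hM⟩ := exists_transferKernel_le su2Rep continuous_su2Rep β (L := L)
  have hψint : Integrable ψ (configMeasure SU2 L) :=
    Integrable.mono' (integrable_const C) hψ.measurable.aestronglyMeasurable
      (ae_of_all _ fun V => by rw [Real.norm_eq_abs]; exact hC V)
  have hTm : Measurable (transferApply (L := L) β ψ) := measurable_transferApply β hψ.measurable
  have hTb : ∀ U, |transferApply β ψ U| ≤ M * C := abs_transferApply_le β hM hψ.measurable hC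
  have hprod : Integrable (fun U => ψ U * transferApply β ψ U) (configMeasure SU2 L) := by
    refine Integrable.mono' (integrable_const (C * (M * C))) (hψ.measurable.mul hTm).aestronglyMeasurable
      (ae_of_all _ fun U => ?_)
    rw [Real.norm_eq_abs, abs_mul]
    exact mul_le_mul (hC U) (hTb U) (abs_nonneg _) ((abs_nonneg _).trans (hC U))
  have hle := integral_mono (hψint.mul_const (m * I)) hprod hptw
  rw [integral_mul_const] at hle
  calc m * I ^ 2 = I * (m * I) := by ring
    _ ≤ _ := hle

/-- ★ **Clause 1 of `LargeFieldInsensitivity` (stmt-QuantumFields-25696), unconditionally**: the SF_κ-compressed top value is positive on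
every lattice, for every `β > 0` and every `κ` — witness `1_{SF}`, the indicator of the small-field region (physical, supported in SF, of
positive mass since SF is a neighbourhood of the trivial configuration, with `⟨1_{SF}, K_β 1_{SF}⟩ ≥ (inf K_β) μ(SF)² > 0`).
[cite: ReedSimonIV1978, Thm. XIII.1] -/
theorem smallFieldTop_pos (L : ℕ) [NeZero L] {β : ℝ} (hβ : 0 < β) (κ : ℝ) :
    0 < sSup (rayleighSet su2Rep L β fun ψ => ∀ U : GaugeConfig 3 L SU2,
      (∃ p : Plaquette 3 L, β ^ (κ - 1) < 2 - (su2Rep (plaquetteHolonomy U p.1 p.2.1.1 p.2.1.2)).trace.re) → ψ U = 0) := by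
  set c : ℝ := β ^ (κ - 1) with hc
  have hcpos : 0 < c := Real.rpow_pos_of_pos hβ _
  set S : Set (GaugeConfig 3 L SU2) := {U | ¬ ∃ p : Plaquette 3 L,
    c < 2 - (su2Rep (plaquetteHolonomy U p.1 p.2.1.1 p.2.1.2)).trace.re} with hS
  set ψ : GaugeConfig 3 L SU2 → ℝ := S.indicator fun _ => (1 : ℝ) with hψdef
  have hψ : IsPhys ψ := (sf_cutoffs_isPhys c (isPhys_const 1)).1
  have hψ0 : ∀ V, 0 ≤ ψ V := fun V => Set.indicator_nonneg (fun _ _ => zero_le_one) V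
  have hP : ∀ U : GaugeConfig 3 L SU2,
      (∃ p : Plaquette 3 L, c < 2 - (su2Rep (plaquetteHolonomy U p.1 p.2.1.1 p.2.1.2)).trace.re) → ψ U = 0 := by
    intro U hU
    have hUS : U ∉ S := fun h => h hU
    simp [hψdef, Set.indicator_of_notMem hUS]
  -- `S` is measurable and contains an open neighbourhood of the trivial configuration
  have hSm : MeasurableSet S := by
    have h : {U : GaugeConfig 3 L SU2 | ∃ p : Plaquette 3 L, c < 2 - (su2Rep (plaquetteHolonomy U p.1 p.2.1.1 p.2.1.2)).trace.re}
        = ⋃ p : Plaquette 3 L, {U | c < 2 - (su2Rep (plaquetteHolonomy U p.1 p.2.1.1 p.2.1.2)).trace.re} := by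
      ext U; simp only [Set.mem_setOf_eq, Set.mem_iUnion]
    have hm : MeasurableSet {U : GaugeConfig 3 L SU2 | ∃ p : Plaquette 3 L,
        c < 2 - (su2Rep (plaquetteHolonomy U p.1 p.2.1.1 p.2.1.2)).trace.re} := by
      rw [h]
      exact MeasurableSet.iUnion fun p => measurableSet_lt measurable_const (continuous_plaquetteDeviation p).measurable
    have := hm.compl
    rwa [Set.compl_setOf] at this
  set O : Set (GaugeConfig 3 L SU2) := ⋂ p : Plaquette 3 L,
    {U | 2 - (su2Rep (plaquetteHolonomy U p.1 p.2.1.1 p.2.1.2)).trace.re < c} with hO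
  have hOopen : IsOpen O :=
    isOpen_iInter_of_finite fun p => isOpen_lt (continuous_plaquetteDeviation p) continuous_const
  have hOne : (1 : GaugeConfig 3 L SU2) ∈ O := by
    simp only [hO, Set.mem_iInter, Set.mem_setOf_eq]
    intro p
    have : (su2Rep (plaquetteHolonomy (1 : GaugeConfig 3 L SU2) p.1 p.2.1.1 p.2.1.2)).trace.re = 2 := by
      rw [plaquetteHolonomy_one, map_one, Matrix.trace_one]
      simp
    rw [this]; linarith
  have hOS : O ⊆ S := by
    intro U hU hex
    obtain ⟨p, hp⟩ := hex
    have hU' : 2 - (su2Rep (plaquetteHolonomy U p.1 p.2.1.1 p.2.1.2)).trace.re < c := by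
      have := Set.mem_iInter.mp hU p
      simpa only [Set.mem_setOf_eq] using this
    linarith
  haveI := PhysL2.isOpenPosMeasure_configMeasure (L := L)
  have hμO : 0 < (configMeasure SU2 L) O := hOopen.measure_pos _ ⟨1, hOne⟩
  have hμS : 0 < (configMeasure SU2 L).real S := by
    rw [Measure.real, ENNReal.toReal_pos_iff]
    exact ⟨lt_of_lt_of_le hμO (measure_mono hOS), measure_lt_top _ _⟩
  -- `‖ψ‖² = μ(S) > 0`
  have hint1 : ∫ V, ψ V ∂(configMeasure SU2 L) = (configMeasure SU2 L).real S := by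
    rw [hψdef]
    exact integral_indicator_one hSm
  have hl2 : l2 ψ ψ = (configMeasure SU2 L).real S := by
    unfold l2
    have : (fun U => ψ U * ψ U) = ψ := by
      funext U
      by_cases hU : U ∈ S
      · simp [hψdef, Set.indicator_of_mem hU]
      · simp [hψdef, Set.indicator_of_notMem hU]
    rw [this, hint1]
  have hl2pos : 0 < l2 ψ ψ := by rw [hl2]; exact hμS
  -- `⟨ψ, K_β ψ⟩ ≥ (inf K) μ(S)² > 0`
  obtain ⟨m, hm0, hm⟩ := exists_pos_le_transferKernel su2Rep continuous_su2Rep β (L := L)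
  have hq : 0 < qform su2Rep β ψ ψ := by
    have h := sq_integral_le_qform β hm hψ hψ0
    rw [hint1] at h
    exact lt_of_lt_of_le (by positivity) h
  exact sSup_rayleighSet_pos_of_witness β hψ hP hl2pos hq

end Summit.QuantumFields.YangMills.Theorems.FemtoTransferGap.SFCompression

end
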